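import Summits.HodgeConjecture.HodgeConjecture.Theorems.NikulinTwinTransportTwinSimilitudeAlgebraicOutAnchorGlue
import Summits.HodgeConjecture.HodgeConjecture.Theorems.NikulinTwinTransportTwinSimilitudeAlgebraicStubDivisorCorrections
import Summits.HodgeConjecture.HodgeConjecture.Theorems.NikulinTwinTransportTwinSimilitudeAlgebraicStubWittCompletion
import Summits.HodgeConjecture.HodgeConjecture.Theorems.NikulinTwinTransportTwinSimilitudeAlgebraicStubOutAnchorOfSimilitude
import Summits.HodgeConjecture.HodgeConjecture.Theorems.NikulinTwinTransportTwinSimilitudeAlgebraicStubHodgeK3FactsAux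
import Summits.HodgeConjecture.HodgeConjecture.Theorems.NikulinTwinTransportTwinSimilitudeAlgebraicStubHkTwinClassAssembly
import Summits.HodgeConjecture.HodgeConjecture.Theorems.NikulinTwinTransportTwinSimilitudeAlgebraicStubHkLatticeWitt
import Literature.AlgebraicGeometry.HodgeTheory.GysinBaseChange
import HarnessLib

/-!
# Route NikulinTwinTransport · crux X = `TwinSimilitudeAlgebraic` (stmt-HodgeConjecture-13674) —
# THE SECTOR THEOREM of line `hyperkaehler-nikulin-anchors` (the line's deliverable)

The proved glue of the checked skeleton `Cruxes/TwinSimilitudeAlgebraic/Lines/hyperkaehler_nikulin_anchors.lean`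
(reshape r3, lead prover-line-stmt-HodgeConjecture-13674-c1-0) moved under `Theorems/`, now that every
line-internal stub is a theorem of the tree (`stub_divisorCorrections` p97661, `stub_wittCompletion`
p104519, `stub_outAnchorOfSimilitude` p106118, `stub_markingPeriodPt` p111899, `stub_corrCalculus`
p111937, `stub_hkLatticeWitt`, `stub_hkTwinClassAssembly`):

* `outAnchor_onHKSector` — every projective K3 surface in the HK-Nikulin sector (`InHKNikulinSector`:
  `T(S)_ℚ ↪ (U³ ⊕ E₈(−2) ⊕ ⟨−2⟩)_ℚ` isometrically) has an ALGEBRAIC OUT-ANCHOR `2`-similitude into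
  the fixed K3 surface of a symplectic involution on a projective `K3^{[2]}`-type fourfold;
* `twinSimilitudeAlgebraic_onHKSector` — **THE SECTOR THEOREM: X holds for every pair `(S, S′)` of
  projective K3 surfaces whose SOURCE `S′` lies in the HK-Nikulin sector**, i.e. every rational,
  type-preserving `2`-similitude `ψ : H²(S′(ℂ); ℂ) → H²(S(ℂ); ℂ)` is `fst_*(snd^* – ∪ γ)` for an
  algebraic `γ` on `S ⊗ S′` — GRANTED: the named Literature facts (K3 markings exist; the four
  hyperkähler facts `CamereEtAl2026_symplecticInvolution_periodSurjective`,
  `CamereEtAl2023_fixedK3_restriction`, `Markman2024_rationalHodgeIsometry_algebraic_marked`,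
  `Beauville1983_hilbertSquare_markedIncidence`), the support item `CupProductAlgebraic` of route
  EndoscopicMiddleDegree (stmt-HodgeConjecture-14350, the moving lemma — behind every composition of
  correspondences), and three items of NikulinTwinTransport by name: Buskin `HodgeIsometryAlgebraic`
  (13675), `LefschetzOneOneK3` (13678), `AlgebraicClassesOneOneK3` (15041);
* `twinSimilitudeAlgebraic_of_offHKSectorSources` — hence X itself follows from the same inputs and
  the declared RESIDUAL of the line (X for sources OFF the sector, implied by the transport crux
  `TwinTwistorTransport`, 14393): the exact shape of what remains of the crux after this line.

NEW CASES OF X (conditionally on the inputs above): sources with `rank T(S′) = 14` (`ρ = 8`, e.g.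
`T ≅ ⟨−2d⟩ ⊕ U² ⊕ ⟨−2⟩ ⊕ E₈(−1)`), off the Nikulin / Kummer / CM loci (the sector strictly contains
Varesco's Nikulin locus `T_ℚ ↪ (U³ ⊕ E₈(−2))_ℚ`, rank `≤ 13`).  No definitions, no new named facts.

## References

* [CamereEtAl2026] C. Camere, A. Garbagnati, G. Kapustka, M. Kapustka, arXiv:2607.00130, Thm. 1.2, Thm. 5.12.
* [Markman2024] E. Markman, Compos. Math. 160 (2024), Thm. 1.1.
* [Varesco2023] M. Varesco, Math. Z. 305 (2023), Thm. 2.1 and Prop. 2.5.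
* [Buskin2019] N. Buskin, J. reine angew. Math. 755 (2019), Thm. 1.1 and Lemma 6.3.
* [Mongardi2011] G. Mongardi, Cent. Eur. J. Math. 10 (2012), Thm. 4.1, Thm. 5.2.
-/

noncomputable section

set_option linter.dupNamespace false

open CategoryTheory MonoidalCategory
open scoped Manifold Matrix
open Literature.AlgebraicGeometry.Motives Literature.AlgebraicGeometry.HodgeTheory
open Literature.AlgebraicGeometry.Surfaces Literature.AlgebraicGeometry.Hyperkaehler Literature.Geometry.Kaehler
open Literature.AlgebraicTopology.SingularHomology
open Summit.HodgeConjecture.HodgeConjecture.Theses.NikulinTwinTransport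

namespace Summit.HodgeConjecture.HodgeConjecture.Theorems.NikulinTwinTransport

/-! ## Local notations (verbatim those of the skeleton / the route's Theorems files) -/

/-- `Gen[S, p]`: `p` is an integral generator of `H⁴(S(ℂ); ℂ)` (the generator clause of X). Local notation
only. -/
local notation3 (prettyPrint := false) "Gen[" S ", " p "]" =>
  (IsIntegralClass p ∧ ∀ q : complexBetti S (2 * 2), IsIntegralClass q → ∃ n : ℤ, q = n • p)

/-- `Corr[μ, S, S', hS, hS' ; γ, y] = [γ]_* y = fst_*(snd^* y ∪ γ)`, the action of
`γ ∈ H⁴((S ⊗ S′)(ℂ); ℂ)` as a correspondence `H²(S′) → H²(S)` (the FIRST factor receives). Local notation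
only, verbatim from the route's Theorems files; for `hS hS'` the K3 witnesses it is definitionally the
inline term of the route items. -/
local notation3 (prettyPrint := false) "Corr[" μ ", " S ", " S' ", " hS ", " hS' " ; " γ ", " y "]" =>
  complexGysin μ
    (IsSmoothProjective.tensor_holds (IsK3Surface.isSmoothProjective hS)
      (IsK3Surface.isSmoothProjective hS'))
    (IsK3Surface.isSmoothProjective hS) (SemiCartesianMonoidalCategory.fst S S')
    (rfl : 2 * 1 + 2 * 2 + 2 * 2 = 2 * 1 + 2 * (2 + 2))
    (cupProduct (rfl : 2 * 1 + 2 * 2 = 2 * 1 + 2 * 2)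
      (complexBetti.map (SemiCartesianMonoidalCategory.snd S S') (2 * 1) y) γ)

/-- `CompCorr`: composition of algebraic degree-`2` correspondences between smooth projective surfaces
acts as an algebraic correspondence — hypothesis (C) of `twinSimilitudeAlgebraic_of_anchor`, verbatim
(the tree proves it from the multiplicativity `N² ∪ N² ⊆ N⁴`: `corrComp_surfaces_of_cup'`; route item
`TwinAnchorGlue` is its packaged use). Local notation only. -/
local notation3 (prettyPrint := false) "CompCorr" =>
  ∀ (μ : OrientationFamily), μ.HasPoincareDuality →
    ∀ (A B C : SchemeOver ℂ) (hA : IsSmoothProjective 2 A) (hB : IsSmoothProjective 2 B)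
      (hC : IsSmoothProjective 2 C),
      ∀ γ ∈ algebraicClasses (MonoidalCategoryStruct.tensorObj A B) 2,
        ∀ γ₁ ∈ algebraicClasses (MonoidalCategoryStruct.tensorObj B C) 2,
          ∃ γ₂ ∈ algebraicClasses (MonoidalCategoryStruct.tensorObj A C) 2,
            ∀ x : complexBetti C (2 * 1),
              complexGysin μ (IsSmoothProjective.tensor_holds hA hC) hA
                  (SemiCartesianMonoidalCategory.fst A C)
                  (rfl : 2 * 1 + 2 * 2 + 2 * 2 = 2 * 1 + 2 * (2 + 2))
                  (cupProduct (rfl : 2 * 1 + 2 * 2 = 2 * 1 + 2 * 2)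
                    (complexBetti.map (SemiCartesianMonoidalCategory.snd A C) (2 * 1) x) γ₂) =
                complexGysin μ (IsSmoothProjective.tensor_holds hA hB) hA
                  (SemiCartesianMonoidalCategory.fst A B)
                  (rfl : 2 * 1 + 2 * 2 + 2 * 2 = 2 * 1 + 2 * (2 + 2))
                  (cupProduct (rfl : 2 * 1 + 2 * 2 = 2 * 1 + 2 * 2)
                    (complexBetti.map (SemiCartesianMonoidalCategory.snd A B) (2 * 1)
                      (complexGysin μ (IsSmoothProjective.tensor_holds hB hC) hB
                        (SemiCartesianMonoidalCategory.fst B C)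
                        (rfl : 2 * 1 + 2 * 2 + 2 * 2 = 2 * 1 + 2 * (2 + 2))
                        (cupProduct (rfl : 2 * 1 + 2 * 2 = 2 * 1 + 2 * 2)
                          (complexBetti.map (SemiCartesianMonoidalCategory.snd B C) (2 * 1) x)
                          γ₁)))
                    γ)

/-- `OutAnchor[μ, S, Sg, hS, hSg, p, pg]`: AN ALGEBRAIC OUT-ANCHOR `2`-SIMILITUDE AT `S` WITH PARTNER
`Sg` — a `ℂ`-linear equivalence `Ψ : H²(S) ≃ H²(Sg)` which is algebraic (the action of an algebraic
class on `Sg ⊗ S`) and whose inverse is rational, type-preserving and HALVES the cup form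
(`(u.v) = 2b·pg ⟹ (Ψ⁻¹u.Ψ⁻¹v) = b·p`).  Symbol for symbol the body of `AnchorData[μ, Sg, hSg, pg]`
(= the body of the route crux `TwinTwistorTransport` at `Sg`) with the partner `S″ := S`, `p″ := p`.
Local notation only. -/
local notation3 (prettyPrint := false)
    "OutAnchor[" μ ", " S ", " Sg ", " hS ", " hSg ", " p ", " pg "]" =>
  ∃ Ψ : complexBetti S (2 * 1) ≃ₗ[ℂ] complexBetti Sg (2 * 1),
    (∀ y, IsRationalClass y → IsRationalClass (Ψ.symm y)) ∧
    (∀ (i j : ℕ) y, IsOfHodgeType 2 Sg (2 * 1) i j y →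
      IsOfHodgeType 2 S (2 * 1) i j (Ψ.symm y)) ∧
    (∀ (u v : complexBetti Sg (2 * 1)) (b : ℂ),
      cupProduct (rfl : 2 * 1 + 2 * 1 = 2 * 2) u v = ((2 : ℂ) * b) • pg →
        cupProduct (rfl : 2 * 1 + 2 * 1 = 2 * 2) (Ψ.symm u) (Ψ.symm v) = b • p) ∧
    ∃ γ ∈ algebraicClasses (MonoidalCategoryStruct.tensorObj Sg S) 2,
      ∀ x : complexBetti S (2 * 1), Ψ x = Corr[μ, Sg, S, hSg, hS ; γ, x]

/-! ## The glue -/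

/-- **`CompCorr` from `CupProductAlgebraic`**: the tree's `corrComp_surfaces_of_cup'` needs only
`N² ∪ N² ⊆ N⁴` on the sixfolds `A ⊗ (B ⊗ C)`, an instance of the item.
[cite: Fulton1998, §16.1 Prop. 16.1.1] [cite: Buskin2019, Lemma 6.3] -/
theorem compCorr_of_cupProductAlgebraic'
    (h : Summit.HodgeConjecture.HodgeConjecture.Theses.EndoscopicMiddleDegree.CupProductAlgebraic) :
    CompCorr :=
  corrComp_surfaces_of_cup' fun _ _ _ hA hB hC a ha b hb =>
    h (IsSmoothProjective.tensor_holds hA (IsSmoothProjective.tensor_holds hB hC)) 2 2 a b ha hb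

/-- **OUT-ANCHORS ON THE HK-NIKULIN SECTOR**: every projective K3 surface in the sector has an
algebraic out-anchor `2`-similitude into some projective K3 surface — the heart (partial twin class,
`stub_hkTwinClassAssembly` fed with the lattice datum `stub_hkLatticeWitt`) completed by products of
divisors (`stub_divisorCorrections`, `stub_wittCompletion`) and recognised as an out-anchor
(`stub_outAnchorOfSimilitude`).  Granted the facts, `CupProductAlgebraic` and the two `(1,1)` items.
[cite: CamereEtAl2026, Thm. 5.12] [cite: Markman2024, Thm. 1.1] [cite: Varesco2023, §2] -/
theorem outAnchor_onHKSector
    (h₀ : (Huybrechts_K3_marking_exists ∧ CamereEtAl2026_symplecticInvolution_periodSurjective ∧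
        CamereEtAl2023_fixedK3_restriction ∧ Markman2024_rationalHodgeIsometry_algebraic_marked ∧
        Beauville1983_hilbertSquare_markedIncidence))
    (hC : Summit.HodgeConjecture.HodgeConjecture.Theses.EndoscopicMiddleDegree.CupProductAlgebraic)
    (hL : LefschetzOneOneK3) (hN : AlgebraicClassesOneOneK3) {μ : OrientationFamily}
    (hμ : μ.HasPoincareDuality) {S : SchemeOver ℂ} (hS : IsK3Surface S) {p : complexBetti S (2 * 2)}
    (hp : Gen[S, p]) (hsec : InHKNikulinSector S) :
    ∃ (Sg : SchemeOver ℂ) (hSg : IsK3Surface Sg) (pg : complexBetti Sg (2 * 2)), Gen[Sg, pg] ∧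
      OutAnchor[μ, S, Sg, hS, hSg, p, pg] := by
  obtain ⟨Sg, hSg, pg, hpg, γ, hγ, hP1, hP2, hP3, hP4, hP5⟩ :=
    stub_hkTwinClassAssembly stub_hkLatticeWitt h₀ hC hL hN μ hμ S hS p hp hsec
  let Φ : complexBetti S (2 * 1) →ₗ[ℂ] complexBetti Sg (2 * 1) :=
    corrAction μ (IsK3Surface.isSmoothProjective hSg) (IsK3Surface.isSmoothProjective hS)
      (rfl : 2 * 1 + 2 * 2 = 2 * 1 + 2 * 2) γ
  obtain ⟨m, a, b, ha, hb, hW⟩ := stub_wittCompletion h₀.1 (hodgeIndex_K3_of_marking h₀.1 hL) hL hN S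
    Sg hS hSg p pg hp hpg Φ hP1 hP2 hP3 hP4 hP5
  have hp0 : p ≠ 0 := generator_ne_zero hS hp.2
  choose γc hγc hact using fun i => stub_divisorCorrections μ hμ S Sg hS hSg p hp0 (a i) (ha i) (b i) (hb i)
  let ν : Fin m → (complexBetti S (2 * 1) →ₗ[ℂ] complexBetti Sg (2 * 1)) := fun i =>
    corrAction μ (IsK3Surface.isSmoothProjective hSg) (IsK3Surface.isSmoothProjective hS)
      (rfl : 2 * 1 + 2 * 2 = 2 * 1 + 2 * 2) (γc i)
  have hν : ∀ i (x : complexBetti S (2 * 1)) (t : ℂ),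
      cupProduct (rfl : 2 * 1 + 2 * 1 = 2 * 2) x (a i) = t • p → ν i x = t • b i :=
    fun i x t hxt => hact i x t hxt
  obtain ⟨hR, hT, hS2⟩ := hW ν hν
  have halg : ∃ γ₀ ∈ algebraicClasses (MonoidalCategoryStruct.tensorObj Sg S) 2,
      ∀ x : complexBetti S (2 * 1), (Φ + ∑ i, ν i) x = Corr[μ, Sg, S, hSg, hS ; γ₀, x] := by
    refine induced_add (IsSmoothProjective.tensor_holds (IsK3Surface.isSmoothProjective hSg)
      (IsK3Surface.isSmoothProjective hS)) (IsK3Surface.isSmoothProjective hSg)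
      (rfl : 2 * 1 + 2 * 2 = 2 * 1 + 2 * 2) (rfl : 2 * 1 + 2 * 2 + 2 * 2 = 2 * 1 + 2 * (2 + 2))
      ⟨γ, hγ, fun x => rfl⟩ ?_
    exact induced_sum (IsSmoothProjective.tensor_holds (IsK3Surface.isSmoothProjective hSg)
      (IsK3Surface.isSmoothProjective hS)) (IsK3Surface.isSmoothProjective hSg)
      (rfl : 2 * 1 + 2 * 2 = 2 * 1 + 2 * 2) (rfl : 2 * 1 + 2 * 2 + 2 * 2 = 2 * 1 + 2 * (2 + 2))
      Finset.univ ν (fun i _ => ⟨γc i, hγc i, fun x => rfl⟩)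
  exact ⟨Sg, hSg, pg, hpg, stub_outAnchorOfSimilitude h₀.1 μ hμ S Sg hS hSg p pg hp hpg (Φ + ∑ i, ν i)
    hR hT hS2 halg⟩

/-- **THE SECTOR THEOREM (module docstring): X for every pair whose SOURCE lies in the HK-Nikulin
sector**, granted the named facts, `CupProductAlgebraic`, Buskin and the two `(1,1)` items: the
out-anchor at the source, Buskin on the rational Hodge isometry `ψ ∘ Ψ⁻¹`, and the composition of
correspondences (`simAlg_at_of_outAnchor`). [cite: CamereEtAl2026, Thm. 1.2 and Thm. 5.12]
[cite: Markman2024, Thm. 1.1] [cite: Varesco2023, Thm. 2.1 and Prop. 2.5] [cite: Buskin2019, Thm. 1.1] -/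
theorem twinSimilitudeAlgebraic_onHKSector
    (h₀ : (Huybrechts_K3_marking_exists ∧ CamereEtAl2026_symplecticInvolution_periodSurjective ∧
        CamereEtAl2023_fixedK3_restriction ∧ Markman2024_rationalHodgeIsometry_algebraic_marked ∧
        Beauville1983_hilbertSquare_markedIncidence))
    (hC : Summit.HodgeConjecture.HodgeConjecture.Theses.EndoscopicMiddleDegree.CupProductAlgebraic)
    (hB : HodgeIsometryAlgebraic) (hL : LefschetzOneOneK3) (hN : AlgebraicClassesOneOneK3)
    {μ : OrientationFamily} (hμ : μ.HasPoincareDuality)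
    (S S' : SchemeOver ℂ) (hS : IsK3Surface S) (hS' : IsK3Surface S')
    (p : complexBetti S (2 * 2)) (p' : complexBetti S' (2 * 2)) (hp : Gen[S, p]) (hp' : Gen[S', p'])
    (hsec : InHKNikulinSector S')
    (ψ : complexBetti S' (2 * 1) →ₗ[ℂ] complexBetti S (2 * 1))
    (hψr : ∀ x, IsRationalClass x → IsRationalClass (ψ x))
    (hψt : ∀ (i j : ℕ) x, IsOfHodgeType 2 S' (2 * 1) i j x → IsOfHodgeType 2 S (2 * 1) i j (ψ x))
    (hψs : ∀ (x y : complexBetti S' (2 * 1)) (a : ℂ),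
      cupProduct (rfl : 2 * 1 + 2 * 1 = 2 * 2) x y = a • p' →
        cupProduct (rfl : 2 * 1 + 2 * 1 = 2 * 2) (ψ x) (ψ y) = ((2 : ℂ) * a) • p) :
    ∃ γ ∈ algebraicClasses (MonoidalCategoryStruct.tensorObj S S') 2,
      ∀ x : complexBetti S' (2 * 1), ψ x = Corr[μ, S, S', hS, hS' ; γ, x] := by
  obtain ⟨Sg, hSg, pg, hpg, hA⟩ := outAnchor_onHKSector h₀ hC hL hN hμ hS' hp' hsec
  exact simAlg_at_of_outAnchor hB (compCorr_of_cupProductAlgebraic' hC) hμ hS' hSg hpg hA S hS p hp ψ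
    hψr hψt hψs

/-- **X from the same inputs and the declared residual** (X verbatim for sources OFF the sector — the
honest name of what this line leaves of the crux; implied by the transport crux `TwinTwistorTransport`,
stmt-HodgeConjecture-14393, through Buskin and `TwinAnchorGlue`): by cases on the sector at the
source. A CONDITIONAL proof of the route's crux `TwinSimilitudeAlgebraic`. [cite: Varesco2023, Thm. 2.1 and Prop. 2.5]
[cite: CamereEtAl2026, Thm. 1.2] -/
theorem twinSimilitudeAlgebraic_of_offHKSectorSources
    (h₀ : (Huybrechts_K3_marking_exists ∧ CamereEtAl2026_symplecticInvolution_periodSurjective ∧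
        CamereEtAl2023_fixedK3_restriction ∧ Markman2024_rationalHodgeIsometry_algebraic_marked ∧
        Beauville1983_hilbertSquare_markedIncidence))
    (hC : Summit.HodgeConjecture.HodgeConjecture.Theses.EndoscopicMiddleDegree.CupProductAlgebraic)
    (hB : HodgeIsometryAlgebraic) (hL : LefschetzOneOneK3) (hN : AlgebraicClassesOneOneK3)
    (hoff : ∀ (μ : OrientationFamily), μ.HasPoincareDuality →
      ∀ (S S' : SchemeOver ℂ) (hS : IsK3Surface S) (hS' : IsK3Surface S')
        (p : complexBetti S (2 * 2)) (p' : complexBetti S' (2 * 2)), Gen[S, p] → Gen[S', p'] →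
        ∀ (ψ : complexBetti S' (2 * 1) →ₗ[ℂ] complexBetti S (2 * 1)),
          (∀ x, IsRationalClass x → IsRationalClass (ψ x)) →
          (∀ (i j : ℕ) x, IsOfHodgeType 2 S' (2 * 1) i j x → IsOfHodgeType 2 S (2 * 1) i j (ψ x)) →
          (∀ (x y : complexBetti S' (2 * 1)) (a : ℂ),
            cupProduct (rfl : 2 * 1 + 2 * 1 = 2 * 2) x y = a • p' →
              cupProduct (rfl : 2 * 1 + 2 * 1 = 2 * 2) (ψ x) (ψ y) = ((2 : ℂ) * a) • p) →
          ¬ InHKNikulinSector S' →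
          ∃ γ ∈ algebraicClasses (MonoidalCategoryStruct.tensorObj S S') 2,
            ∀ x : complexBetti S' (2 * 1), ψ x = Corr[μ, S, S', hS, hS' ; γ, x]) :
    Summit.HodgeConjecture.HodgeConjecture.Theses.NikulinTwinTransport.TwinSimilitudeAlgebraic := by
  intro μ hμ S S' hS hS' p p' hp hp' ψ hψr hψt hψs
  by_cases hsec : InHKNikulinSector S'
  · exact twinSimilitudeAlgebraic_onHKSector h₀ hC hB hL hN hμ S S' hS hS' p p' hp hp' hsec ψ hψr hψt hψs
  · exact hoff μ hμ S S' hS hS' p p' hp hp' ψ hψr hψt hψs hsec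

/-- Registered anchor of this file: closed form of `twinSimilitudeAlgebraic_of_offHKSectorSources` — X
from the named facts, `CupProductAlgebraic`, Buskin, the two `(1,1)` items and the declared residual.
[cite: CamereEtAl2026, Thm. 1.2] [cite: Varesco2023, Thm. 2.1 and Prop. 2.5] -/
theorem hkSectorTheorem_anchor :
    (Huybrechts_K3_marking_exists ∧ CamereEtAl2026_symplecticInvolution_periodSurjective ∧
        CamereEtAl2023_fixedK3_restriction ∧ Markman2024_rationalHodgeIsometry_algebraic_marked ∧
        Beauville1983_hilbertSquare_markedIncidence) →
    Summit.HodgeConjecture.HodgeConjecture.Theses.EndoscopicMiddleDegree.CupProductAlgebraic →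
    HodgeIsometryAlgebraic → LefschetzOneOneK3 → AlgebraicClassesOneOneK3 →
    (∀ (μ : OrientationFamily), μ.HasPoincareDuality →
      ∀ (S S' : SchemeOver ℂ) (hS : IsK3Surface S) (hS' : IsK3Surface S')
        (p : complexBetti S (2 * 2)) (p' : complexBetti S' (2 * 2)), Gen[S, p] → Gen[S', p'] →
        ∀ (ψ : complexBetti S' (2 * 1) →ₗ[ℂ] complexBetti S (2 * 1)),
          (∀ x, IsRationalClass x → IsRationalClass (ψ x)) →
          (∀ (i j : ℕ) x, IsOfHodgeType 2 S' (2 * 1) i j x → IsOfHodgeType 2 S (2 * 1) i j (ψ x)) →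
          (∀ (x y : complexBetti S' (2 * 1)) (a : ℂ),
            cupProduct (rfl : 2 * 1 + 2 * 1 = 2 * 2) x y = a • p' →
              cupProduct (rfl : 2 * 1 + 2 * 1 = 2 * 2) (ψ x) (ψ y) = ((2 : ℂ) * a) • p) →
          ¬ InHKNikulinSector S' →
          ∃ γ ∈ algebraicClasses (MonoidalCategoryStruct.tensorObj S S') 2,
            ∀ x : complexBetti S' (2 * 1), ψ x = Corr[μ, S, S', hS, hS' ; γ, x]) →
    Summit.HodgeConjecture.HodgeConjecture.Theses.NikulinTwinTransport.TwinSimilitudeAlgebraic :=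
  fun h₀ hC hB hL hN hoff => twinSimilitudeAlgebraic_of_offHKSectorSources h₀ hC hB hL hN hoff

end Summit.HodgeConjecture.HodgeConjecture.Theorems.NikulinTwinTransport

end
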